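import Mathlib
import Summits.Ventures.PercRepro2.HCov
import Summits.Ventures.PercRepro2.BHKAvoid
import Summits.Ventures.PercRepro2.ExploreA3
import Summits.Ventures.PercRepro2.RootLeafUSigns

/-!
# Exploring the cluster of `s` under set avoidance: the tower bound and the cross-cluster inequality
with a decreasing factor (blind cell PercRepro2, p4 g24; S3 (G4-u), proofs/P4-G24-OPOCKETL-MASTER.md §2)

Three general facts behind the whole-instance claims (i) and (iii) of the o-pocket `L` half, all by the
exploration identity `prob_clusterIn_inter_avoid_eq_expect` (explore `C_s`; on `{s ↮ X}` with `t ∈ X` the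
cluster of `t` lives in `G ∖ C_s`, with law `delClusterProb`):

* **`prob_clusterIn_inter_avoid_le_mul`** (the tower bound): for any family `𝓤` and an up-set `𝓥`,
  `P(C_s ∈ 𝓤, C_t ∈ 𝓥, s ↮ X) ≤ P(C_s ∈ 𝓤, s ↮ X) · P(C_t ∈ 𝓥)` — the residual probability
  `P_{G ∖ C_s}(C_t ∈ 𝓥)` is at most the global one (`delClusterProb_anti` from `W = ∅`);
* **`prob_clusterIn_inter_avoid_le_mul_of_lower`** (tower + Harris on `G ∖ C_s`): for a down-set `𝓥₁`
  and an up-set `𝓥₂`, `P(C_s ∈ 𝓤, C_t ∈ 𝓥₁ ∩ 𝓥₂, s ↮ X) ≤ P(C_s ∈ 𝓤, C_t ∈ 𝓥₁, s ↮ X) · P(C_t ∈ 𝓥₂)`;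
* **`bhk_cross_cluster_avoid_lower`** (BHK06 Thm 1.4 with a decreasing factor on the `t` side): for an
  up-set `𝓤` of `C_s`, a down-set `𝓥₁` and an up-set `𝓥₂` of `C_t`,
  `P(C_s ∈ 𝓤, C_t ∈ 𝓥₁ ∩ 𝓥₂, s ↮ X) · P(s ↮ X) ≤ P(C_s ∈ 𝓤, C_t ∈ 𝓥₁, s ↮ X) · P(C_t ∈ 𝓥₂, s ↮ X)`
  — Harris on `G ∖ C_s` splits the `t`-side probability, and `1_𝓤(C_s) · P_{G∖C_s}(C_t ∈ 𝓥₁)` is a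
  nonnegative increasing functional of `C_s` (`delClusterProb_mono`), so the functional same-cluster
  inequality `bhk_induced` (with `F₂ = 1 − P_{G∖C_s}(C_t ∈ 𝓥₂)`) closes it exactly as in
  `bhk_cross_cluster_avoid` (which is the case `𝓥₁ = univ`).
-/

namespace Summit.Ventures.PercRepro2

open UnionCluster CovForm

namespace RootLeafU

namespace TowerBHK

variable {V : Type*} {E : Type*} [Fintype E] [DecidableEq E] [Fintype V] [DecidableEq V]
  {R : Type*} [Field R] [LinearOrder R] [IsStrictOrderedRing R]

section DelCluster

variable (p : E → R) (ends : E → Sym2 V) (t : V)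

omit [Fintype E] [DecidableEq E] [Fintype V] [DecidableEq V] in
/-- For a down-set `𝓥`, `{C_t ∈ 𝓥 in G ∖ W}` is a decreasing event. -/
lemma isLowerSet_delCluster (W : Set V) {𝓥 : Set (Set V)} (h𝓥 : IsLowerSet 𝓥) :
    IsLowerSet {ω : Config E | cluster ends (delConfig ends W ω) t ∈ 𝓥} :=
  fun _ _ h hω => h𝓥 (cluster_mono (ExploreA3.delConfig_mono ends W h) t) hω

omit [Fintype V] [DecidableEq V] in
/-- For a down-set `𝓥`, `g(W) = P_{G ∖ W}(C_t ∈ 𝓥)` is monotone in `W`. -/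
lemma delClusterProb_mono (hp : IsProbVec p) {𝓥 : Set (Set V)} (h𝓥 : IsLowerSet 𝓥) :
    Monotone (delClusterProb p ends t 𝓥) := by
  intro W W' h
  unfold delClusterProb
  refine prob_mono hp fun ω hω => ?_
  exact h𝓥 (cluster_mono (delConfig_anti h ω) t) hω

omit [Fintype V] [DecidableEq V] in
/-- For an up-set `𝓥`, `P_{G ∖ W}(C_t ∈ 𝓥) ≤ P(C_t ∈ 𝓥)`. -/
lemma delClusterProb_le_prob (hp : IsProbVec p) {𝓥 : Set (Set V)} (h𝓥 : IsUpperSet 𝓥) (W : Set V) :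
    delClusterProb p ends t 𝓥 W ≤ prob p (clusterInEvent ends t 𝓥) := by
  unfold delClusterProb
  refine prob_mono hp fun ω hω => ?_
  exact h𝓥 (cluster_mono (delConfig_le ends W ω) t) hω

omit [Fintype V] [DecidableEq V] in
/-- **Harris on `G ∖ W`, mixed**: for a down-set `𝓥₁` and an up-set `𝓥₂`,
`P_{G∖W}(C_t ∈ 𝓥₁ ∩ 𝓥₂) ≤ P_{G∖W}(C_t ∈ 𝓥₁) · P_{G∖W}(C_t ∈ 𝓥₂)`. -/
lemma delClusterProb_inter_le_mul (hp : IsProbVec p) {𝓥₁ 𝓥₂ : Set (Set V)} (h₁ : IsLowerSet 𝓥₁)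
    (h₂ : IsUpperSet 𝓥₂) (W : Set V) :
    delClusterProb p ends t (𝓥₁ ∩ 𝓥₂) W ≤
      delClusterProb p ends t 𝓥₁ W * delClusterProb p ends t 𝓥₂ W := by
  have e : {ω : Config E | cluster ends (delConfig ends W ω) t ∈ 𝓥₁ ∩ 𝓥₂} =
      {ω : Config E | cluster ends (delConfig ends W ω) t ∈ 𝓥₁} ∩
        {ω : Config E | cluster ends (delConfig ends W ω) t ∈ 𝓥₂} := by
    ext ω
    simp only [Set.mem_setOf_eq, Set.mem_inter_iff]
  unfold delClusterProb
  rw [e]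
  exact prob_inter_le_prob_mul_prob_of_isLowerSet hp (isLowerSet_delCluster ends t W h₁)
    (ExploreA3.isUpperSet_delCluster ends t W h₂)

end DelCluster

section Tower

variable (p : E → R) (ends : E → Sym2 V) (s t : V)

omit [DecidableEq V] in
/-- **The tower bound**: for `t ∈ X`, any family `𝓤` and an up-set `𝓥`,
`P(C_s ∈ 𝓤, C_t ∈ 𝓥, s ↮ X) ≤ P(C_s ∈ 𝓤, s ↮ X) · P(C_t ∈ 𝓥)`. -/
theorem prob_clusterIn_inter_avoid_le_mul (hp : IsProbVec p) {X : Finset V} (ht : t ∈ X)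
    (𝓤 : Set (Set V)) {𝓥 : Set (Set V)} (h𝓥 : IsUpperSet 𝓥) :
    prob p (clusterInEvent ends s 𝓤 ∩ clusterInEvent ends t 𝓥 ∩ avoidAll ends s X) ≤
      prob p (clusterInEvent ends s 𝓤 ∩ avoidAll ends s X) * prob p (clusterInEvent ends t 𝓥) := by
  rw [prob_clusterIn_inter_avoid_eq_expect p ends s t ht 𝓤 𝓥,
    prob_clusterInEvent_inter_eq_expect p ends s 𝓤 (avoidAll ends s X),
    mul_comm (expect p _) (prob p _), ← expect_const_mul]
  refine expect_mono hp fun ω => ?_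
  have h1 := delClusterProb_le_prob p ends t hp h𝓥 (cluster ends ω s)
  have h0 : 0 ≤ 𝓤.indicator (1 : Set V → R) (cluster ends ω s) *
      (avoidAll ends s X).indicator 1 ω :=
    mul_nonneg (Set.indicator_apply_nonneg fun _ => zero_le_one)
      (Set.indicator_apply_nonneg fun _ => zero_le_one)
  calc 𝓤.indicator (1 : Set V → R) (cluster ends ω s) *
        delClusterProb p ends t 𝓥 (cluster ends ω s) * (avoidAll ends s X).indicator 1 ω
      = delClusterProb p ends t 𝓥 (cluster ends ω s) *
          (𝓤.indicator (1 : Set V → R) (cluster ends ω s) *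
            (avoidAll ends s X).indicator 1 ω) := by ring
    _ ≤ prob p (clusterInEvent ends t 𝓥) *
          (𝓤.indicator (1 : Set V → R) (cluster ends ω s) *
            (avoidAll ends s X).indicator 1 ω) := mul_le_mul_of_nonneg_right h1 h0

omit [DecidableEq V] in
/-- **Tower + Harris on `G ∖ C_s`**: for `t ∈ X`, any family `𝓤`, a down-set `𝓥₁` and an up-set `𝓥₂`,
`P(C_s ∈ 𝓤, C_t ∈ 𝓥₁ ∩ 𝓥₂, s ↮ X) ≤ P(C_s ∈ 𝓤, C_t ∈ 𝓥₁, s ↮ X) · P(C_t ∈ 𝓥₂)`. -/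
theorem prob_clusterIn_inter_avoid_le_mul_of_lower (hp : IsProbVec p) {X : Finset V} (ht : t ∈ X)
    (𝓤 : Set (Set V)) {𝓥₁ 𝓥₂ : Set (Set V)} (h₁ : IsLowerSet 𝓥₁) (h₂ : IsUpperSet 𝓥₂) :
    prob p (clusterInEvent ends s 𝓤 ∩ clusterInEvent ends t (𝓥₁ ∩ 𝓥₂) ∩ avoidAll ends s X) ≤
      prob p (clusterInEvent ends s 𝓤 ∩ clusterInEvent ends t 𝓥₁ ∩ avoidAll ends s X) *
        prob p (clusterInEvent ends t 𝓥₂) := by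
  rw [prob_clusterIn_inter_avoid_eq_expect p ends s t ht 𝓤 (𝓥₁ ∩ 𝓥₂),
    prob_clusterIn_inter_avoid_eq_expect p ends s t ht 𝓤 𝓥₁,
    mul_comm (expect p _) (prob p _), ← expect_const_mul]
  refine expect_mono hp fun ω => ?_
  have h1 := delClusterProb_inter_le_mul p ends t hp h₁ h₂ (cluster ends ω s)
  have h2 := delClusterProb_le_prob p ends t hp h₂ (cluster ends ω s)
  have hg1 := delClusterProb_nonneg p hp ends t 𝓥₁ (cluster ends ω s)
  have h0 : 0 ≤ 𝓤.indicator (1 : Set V → R) (cluster ends ω s) *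
      (avoidAll ends s X).indicator 1 ω :=
    mul_nonneg (Set.indicator_apply_nonneg fun _ => zero_le_one)
      (Set.indicator_apply_nonneg fun _ => zero_le_one)
  have h3 : delClusterProb p ends t (𝓥₁ ∩ 𝓥₂) (cluster ends ω s) ≤
      prob p (clusterInEvent ends t 𝓥₂) * delClusterProb p ends t 𝓥₁ (cluster ends ω s) := by
    calc delClusterProb p ends t (𝓥₁ ∩ 𝓥₂) (cluster ends ω s)
        ≤ delClusterProb p ends t 𝓥₁ (cluster ends ω s) *
            delClusterProb p ends t 𝓥₂ (cluster ends ω s) := h1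
      _ ≤ delClusterProb p ends t 𝓥₁ (cluster ends ω s) *
            prob p (clusterInEvent ends t 𝓥₂) := mul_le_mul_of_nonneg_left h2 hg1
      _ = prob p (clusterInEvent ends t 𝓥₂) *
            delClusterProb p ends t 𝓥₁ (cluster ends ω s) := mul_comm _ _
  calc 𝓤.indicator (1 : Set V → R) (cluster ends ω s) *
        delClusterProb p ends t (𝓥₁ ∩ 𝓥₂) (cluster ends ω s) * (avoidAll ends s X).indicator 1 ω
      = delClusterProb p ends t (𝓥₁ ∩ 𝓥₂) (cluster ends ω s) *
          (𝓤.indicator (1 : Set V → R) (cluster ends ω s) *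
            (avoidAll ends s X).indicator 1 ω) := by ring
    _ ≤ prob p (clusterInEvent ends t 𝓥₂) * delClusterProb p ends t 𝓥₁ (cluster ends ω s) *
          (𝓤.indicator (1 : Set V → R) (cluster ends ω s) *
            (avoidAll ends s X).indicator 1 ω) := mul_le_mul_of_nonneg_right h3 h0
    _ = prob p (clusterInEvent ends t 𝓥₂) *
          (𝓤.indicator (1 : Set V → R) (cluster ends ω s) *
            delClusterProb p ends t 𝓥₁ (cluster ends ω s) *
            (avoidAll ends s X).indicator 1 ω) := by ring

end Tower

section CrossLower

variable (p : E → R) (ends : E → Sym2 V) (s t : V)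

/-- **BHK06 Thm 1.4 with set avoidance and a decreasing factor on the `t` side**: for `t ∈ X`, an up-set
`𝓤` of `C_s`, a down-set `𝓥₁` and an up-set `𝓥₂` of `C_t`,
`P(C_s ∈ 𝓤, C_t ∈ 𝓥₁ ∩ 𝓥₂, s ↮ X) · P(s ↮ X) ≤ P(C_s ∈ 𝓤, C_t ∈ 𝓥₁, s ↮ X) · P(C_t ∈ 𝓥₂, s ↮ X)`
(`𝓥₁ = univ` is `bhk_cross_cluster_avoid`). -/
theorem bhk_cross_cluster_avoid_lower (hp : IsProbVec p) {X : Finset V} (ht : t ∈ X)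
    {𝓤 𝓥₁ 𝓥₂ : Set (Set V)} (h𝓤 : IsUpperSet 𝓤) (h₁ : IsLowerSet 𝓥₁) (h₂ : IsUpperSet 𝓥₂) :
    prob p (clusterInEvent ends s 𝓤 ∩ clusterInEvent ends t (𝓥₁ ∩ 𝓥₂) ∩ avoidAll ends s X) *
        prob p (avoidAll ends s X) ≤
      prob p (clusterInEvent ends s 𝓤 ∩ clusterInEvent ends t 𝓥₁ ∩ avoidAll ends s X) *
        prob p (clusterInEvent ends t 𝓥₂ ∩ avoidAll ends s X) := by
  classical
  set g₁ := delClusterProb p ends t 𝓥₁ with hg₁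
  set g₂ := delClusterProb p ends t 𝓥₂ with hg₂
  have hg₁_mono : Monotone g₁ := delClusterProb_mono p ends t hp h₁
  have hg₂_anti : Antitone g₂ := delClusterProb_anti p hp ends t h₂
  have hg₁0 : ∀ W, 0 ≤ g₁ W := delClusterProb_nonneg p hp ends t 𝓥₁
  have hg₂1 : ∀ W, g₂ W ≤ 1 := delClusterProb_le_one p hp ends t 𝓥₂
  -- the exploration identities
  have e12 := prob_clusterIn_inter_avoid_eq_expect p ends s t ht 𝓤 (𝓥₁ ∩ 𝓥₂)
  have e1 := prob_clusterIn_inter_avoid_eq_expect p ends s t ht 𝓤 𝓥₁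
  have e2 := prob_clusterIn_inter_avoid_eq_expect p ends s t ht Set.univ 𝓥₂
  simp only [Set.indicator_univ, Pi.one_apply, one_mul] at e2
  have e2' : clusterInEvent ends s Set.univ ∩ clusterInEvent ends t 𝓥₂ ∩ avoidAll ends s X =
      clusterInEvent ends t 𝓥₂ ∩ avoidAll ends s X := by
    ext ω; simp [clusterInEvent]
  rw [e2'] at e2
  -- Harris on `G ∖ C_s`: the `𝓥₁ ∩ 𝓥₂` term is at most the `g₁ · g₂` term
  have hW : 0 ≤ prob p (avoidAll ends s X) := prob_nonneg hp _
  have step1 : prob p (clusterInEvent ends s 𝓤 ∩ clusterInEvent ends t (𝓥₁ ∩ 𝓥₂) ∩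
      avoidAll ends s X) ≤ expect p (fun ω => 𝓤.indicator 1 (cluster ends ω s) *
        (g₁ (cluster ends ω s) * g₂ (cluster ends ω s)) * (avoidAll ends s X).indicator 1 ω) := by
    rw [e12]
    refine expect_mono hp fun ω => ?_
    have h1 := delClusterProb_inter_le_mul p ends t hp h₁ h₂ (cluster ends ω s)
    have h0 : 0 ≤ 𝓤.indicator (1 : Set V → R) (cluster ends ω s) *
        (avoidAll ends s X).indicator 1 ω :=
      mul_nonneg (Set.indicator_apply_nonneg fun _ => zero_le_one)
        (Set.indicator_apply_nonneg fun _ => zero_le_one)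
    calc 𝓤.indicator (1 : Set V → R) (cluster ends ω s) *
          delClusterProb p ends t (𝓥₁ ∩ 𝓥₂) (cluster ends ω s) *
          (avoidAll ends s X).indicator 1 ω
        = delClusterProb p ends t (𝓥₁ ∩ 𝓥₂) (cluster ends ω s) *
            (𝓤.indicator (1 : Set V → R) (cluster ends ω s) *
              (avoidAll ends s X).indicator 1 ω) := by ring
      _ ≤ g₁ (cluster ends ω s) * g₂ (cluster ends ω s) *
            (𝓤.indicator (1 : Set V → R) (cluster ends ω s) *
              (avoidAll ends s X).indicator 1 ω) := mul_le_mul_of_nonneg_right h1 h0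
      _ = 𝓤.indicator (1 : Set V → R) (cluster ends ω s) *
            (g₁ (cluster ends ω s) * g₂ (cluster ends ω s)) *
            (avoidAll ends s X).indicator 1 ω := by ring
  -- the functional same-cluster inequality with `F₁ = 1_𝓤 · g₁`, `F₂ = 1 − g₂`, `X = Y`
  have hF₁ : Monotone (fun W => 𝓤.indicator (1 : Set V → R) W * g₁ W) := by
    intro W W' h
    simp only
    have hi := monotone_indicator_one_of_isUpperSet (R := R) h𝓤 h
    have hi0 : 0 ≤ 𝓤.indicator (1 : Set V → R) W := Set.indicator_apply_nonneg fun _ => zero_le_one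
    calc 𝓤.indicator (1 : Set V → R) W * g₁ W ≤ 𝓤.indicator (1 : Set V → R) W' * g₁ W :=
          mul_le_mul_of_nonneg_right hi (hg₁0 W)
      _ ≤ 𝓤.indicator (1 : Set V → R) W' * g₁ W' :=
          mul_le_mul_of_nonneg_left (hg₁_mono h) (hi0.trans hi)
  have hF₂ : Monotone (fun W => 1 - g₂ W) := fun W W' h => by
    simp only
    linarith [hg₂_anti h]
  have hF₁0 : ∀ W, 0 ≤ 𝓤.indicator (1 : Set V → R) W * g₁ W :=
    fun W => mul_nonneg (Set.indicator_apply_nonneg fun _ => zero_le_one) (hg₁0 W)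
  have hF₂0 : ∀ W, 0 ≤ 1 - g₂ W := fun W => by linarith [hg₂1 W]
  have key := bhk_induced p hp ends s hF₁ hF₂ hF₁0 hF₂0 Finset.univ X X (Finset.subset_univ _)
    (Finset.subset_univ _)
  simp only [Finset.inter_self, Finset.union_self, REvent_univ] at key
  have e : ∀ F : Set V → R, clusterObs ends Finset.univ s F * (avoidAll ends s X).indicator 1 =
      fun ω => F (cluster ends ω s) * (avoidAll ends s X).indicator 1 ω := by
    intro F
    funext ω
    simp only [Pi.mul_apply, clusterObs_apply, clusterIn_univ]
  rw [e, e, e] at key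
  simp only [Pi.mul_apply] at key
  have eR : prob p (avoidAll ends s X) =
      expect p fun ω => (avoidAll ends s X).indicator 1 ω := prob_eq_expect_indicator p _
  have eA : expect p (fun ω => 𝓤.indicator (1 : Set V → R) (cluster ends ω s) * g₁ (cluster ends ω s) *
      (avoidAll ends s X).indicator 1 ω) =
      prob p (clusterInEvent ends s 𝓤 ∩ clusterInEvent ends t 𝓥₁ ∩ avoidAll ends s X) := e1.symm
  have eB : expect p (fun ω => (1 - g₂ (cluster ends ω s)) * (avoidAll ends s X).indicator 1 ω) =
      prob p (avoidAll ends s X) - prob p (clusterInEvent ends t 𝓥₂ ∩ avoidAll ends s X) := by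
    rw [e2, eR, ← expect_sub]
    congr 1
    funext ω
    simp only [Pi.sub_apply]
    ring
  have eC : expect p (fun ω => 𝓤.indicator (1 : Set V → R) (cluster ends ω s) * g₁ (cluster ends ω s) *
      (1 - g₂ (cluster ends ω s)) * (avoidAll ends s X).indicator 1 ω) =
      prob p (clusterInEvent ends s 𝓤 ∩ clusterInEvent ends t 𝓥₁ ∩ avoidAll ends s X) -
        expect p (fun ω => 𝓤.indicator 1 (cluster ends ω s) *
          (g₁ (cluster ends ω s) * g₂ (cluster ends ω s)) * (avoidAll ends s X).indicator 1 ω) := by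
    rw [← eA, ← expect_sub]
    congr 1
    funext ω
    simp only [Pi.sub_apply]
    ring
  rw [eA, eB, eC] at key
  have hA0 : 0 ≤ prob p (clusterInEvent ends s 𝓤 ∩ clusterInEvent ends t 𝓥₁ ∩ avoidAll ends s X) :=
    prob_nonneg hp _
  nlinarith [key, step1, hW, mul_le_mul_of_nonneg_right step1 hW]

end CrossLower

end TowerBHK

end RootLeafU

end Summit.Ventures.PercRepro2
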